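import Summits.Ventures.PercRepro.GenQShareTables
import Summits.Ventures.PercRepro.GenQCovering
import Summits.Ventures.PercRepro.GenQOpenLayersCoreSmall
import Summits.Ventures.PercRepro.GenQOpenLayersCoreFree

/-!
# PercRepro — THE `t = 2` WINDOW OF THE `(10, 8)` ROW ON THE CORE, IN THE KERNEL (night-4, gen 3; sheet §49)

The type-`2` balance `0 ≤ Jq M G 8 2` on every coloop-free rank-`8` flat with at most `15` points of a Core matroid,
by the two charging layers with the endpoint tables of level `8` (`GenQShareTables.lean`) and the covering structure
(`GenQCovering.lean`).  With `k = #(G ∖ B₀)`, `k₃` points of circuit size `3` and the deficit `2/9`: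

* the uniform bounds (`3`-circuit singletons `≥ 2/189`, others `≥ 1/18`, pairs `≥ 1/45`; demand-free `8/21`, `8/25`,
  `2/21`) carry every `(k, k₃)` except `(4, 4)` and `(4, 3)` (`charge_arith_eight`);
* `k = k₃ = 4`: the four `3`-circuits cover the eight basis points exactly, so no two traces meet and every pair
  has `u ≥ 6`, charging `≥ 22/675`: `4·2/189 + 6·22/675 = 0.238 ≥ 2/9`;
* `k = 4`, `k₃ = 3`: if the fourth circuit has `4` points the traces cover with excess `1`, so at most one pair of
  traces meets: `3·2/189 + 1/18 + 1/45 + 5·22/675 = 0.272`; if it has `≥ 5` points its singleton charges `≥ 22/225`: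
  `3·2/189 + 22/225 + 6/45 = 0.263`.

Main statements: `jq_two_nonneg_of_core_eight`, `TenEightResidueCoreFree`, `openLayersCoreFree_eight_of_residue`,
`rls_ten_eight_of_residue`.
-/

namespace PercRepro.GenQ

open Finset ThmH PerFlat SixFour ThmN NightThree

variable {α : Type*} [DecidableEq α] {M : Matroid α} [M.Finite]

/-! ## The charge of a demanding basis is at least `2/9` -/

/-- The arithmetic of the two layers at `q = 8` for every `(k, k₃)` with `k ∈ [2, 7]` except `(4, 4)`, `(4, 3)`. -/
theorem charge_arith_eight (k k₃ : ℕ) (hk : 2 ≤ k) (hk7 : k ≤ 7) (hk₃ : k₃ ≤ k) (hne : ¬ (k = 4 ∧ 3 ≤ k₃))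
    (d₁ d₂ : ℚ) (hd₁0 : 0 ≤ d₁) (hd₁1 : d₁ ≤ 1) (hd₂0 : 0 ≤ d₂) (hd₂1 : d₂ ≤ 1) (hd₁ : k ≤ 2 → d₁ = 0)
    (hd₂ : k ≤ 3 → d₂ = 0) :
    2 / 9 ≤ (k₃ : ℚ) * (8 / 21 - (8 / 21 - 2 / 189) * d₁) + ((k - k₃ : ℕ) : ℚ) * (8 / 25 - (8 / 25 - 1 / 18) * d₁) +
      ((k.choose 2 : ℕ) : ℚ) * (2 / 21 - (2 / 21 - 1 / 45) * d₂) := by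
  interval_cases k <;> interval_cases k₃ <;> norm_num [Nat.choose] at hd₁ hd₂ ⊢ <;>
    first | (norm_num at hne; done) | (subst hd₁; subst hd₂; norm_num) | (subst hd₂; linarith) | linarith

/-- **Every basis `B₀` of a coloop-free `G` with `2 ≤ #(G ∖ B₀) ≤ 7` is charged at least `2/9`** at `q = 8`
(lines `≤ 3` points). -/
theorem tenEight_charge_ge (hs : Simple M) (hline : ∀ L ∈ flatsQ M 2, L.card ≤ 3) {G B₀ : Finset α}
    (hG : G ⊆ gr M) (hrG : M.eRk (G : Set α) = ((8 : ℕ) : ℕ∞)) (hB : B₀ ∈ basesOf M G 8) (hfree : mTr M G = 0)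
    (hk : 2 ≤ (G \ B₀).card) (hk7 : (G \ B₀).card ≤ 7) : 2 / 9 ≤ charge M G 8 B₀ := by
  have hne : B₀.Nonempty := Finset.card_pos.1 (by rw [(mem_basesOf.1 hB).2.2]; norm_num)
  have hc3 : ∀ x ∈ G \ B₀, 3 ≤ (fc M x B₀).card := fun x hx =>
    three_le_card_fc hs ((mem_basesOf.1 hB).1.trans hG) (hG (Finset.mem_sdiff.1 hx).1) (indep_of_mem_basesOf hB)
      (mem_closure_of_mem_basesOf hG hrG hB (Finset.mem_sdiff.1 hx).1) (Finset.mem_sdiff.1 hx).2 hne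
  have hc9 : ∀ x ∈ G \ B₀, (fc M x B₀).card ≤ 9 := fun x _ => by
    have := card_fc_le (M := M) x B₀
    rw [(mem_basesOf.1 hB).2.2] at this
    omega
  have hU5 : ∀ P ∈ (G \ B₀).powersetCard 2, ∀ x ∈ P, ∀ y ∈ P, x ≠ y → 5 ≤ (fc M x B₀ ∪ fc M y B₀).card := by
    intro P hP x hx y hy hxy
    have hPsub := (Finset.mem_powersetCard.1 hP).1
    exact five_le_card_union_fc hs hline hG hrG hB (by norm_num) (Finset.mem_sdiff.1 (hPsub hx)).1
      (Finset.mem_sdiff.1 (hPsub hx)).2 (Finset.mem_sdiff.1 (hPsub hy)).1 (Finset.mem_sdiff.1 (hPsub hy)).2 hxy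
  -- the tables of level `8`
  have t3 := fun x (hx : x ∈ G \ B₀) (h : (fc M x B₀).card = 3) => single_bound_of_table hs hG hrG hB (by norm_num) hx
    (c₀ := 3) (c₁ := 3) (by omega) (by omega) (σ₀ := 8 / 21) (σ₁ := 2 / 189) (by norm_num)
    (by intro c h0 h1; interval_cases c; norm_num) (by intro c h0 h1; interval_cases c; norm_num)
  have t4 := fun x (hx : x ∈ G \ B₀) (h : (fc M x B₀).card ≠ 3) => single_bound_of_table hs hG hrG hB (by norm_num) hx
    (c₀ := 4) (c₁ := 9) (by have := hc3 x hx; omega) (hc9 x hx) (σ₀ := 8 / 25) (σ₁ := 1 / 18) (by norm_num)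
    (by intro c h0 h1; interval_cases c <;> norm_num) (by intro c h0 h1; interval_cases c <;> norm_num)
  have t5 := fun x (hx : x ∈ G \ B₀) (h : 5 ≤ (fc M x B₀).card) => single_bound_of_table hs hG hrG hB (by norm_num) hx
    (c₀ := 5) (c₁ := 9) h (hc9 x hx) (σ₀ := 8 / 25) (σ₁ := 22 / 225) (by norm_num)
    (by intro c h0 h1; interval_cases c <;> norm_num) (by intro c h0 h1; interval_cases c <;> norm_num)
  have tp := fun P (hP : P ∈ (G \ B₀).powersetCard 2) => pair_bound_of_table hs hG hrG hB (by norm_num) hP (u₀ := 5)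
    (by norm_num) (hU5 P hP) (τ₀ := 2 / 21) (τ₁ := 1 / 45) (by norm_num)
    (by intro u h0 h1; interval_cases u <;> norm_num [Nat.choose])
    (by intro u h0 h1; interval_cases u <;> norm_num [Nat.choose])
  have tp6 := fun P (hP : P ∈ (G \ B₀).powersetCard 2)
      (hU6 : ∀ x ∈ P, ∀ y ∈ P, x ≠ y → 6 ≤ (fc M x B₀ ∪ fc M y B₀).card) =>
    pair_bound_of_table hs hG hrG hB (by norm_num) hP (u₀ := 6) (by norm_num) hU6 (τ₀ := 2 / 21) (τ₁ := 22 / 675)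
    (by norm_num) (by intro u h0 h1; interval_cases u <;> norm_num [Nat.choose])
    (by intro u h0 h1; interval_cases u <;> norm_num [Nat.choose])
  -- a non-meeting pair has `u = #C_x + #C_y ≥ 6`
  have hnonmeet : ∀ P ∈ (G \ B₀).powersetCard 2, ¬ MeetingPair M B₀ P →
      ∀ x ∈ P, ∀ y ∈ P, x ≠ y → 6 ≤ (fc M x B₀ ∪ fc M y B₀).card := by
    intro P hP hnm x hx y hy hxy
    have hPsub := (Finset.mem_powersetCard.1 hP).1
    have hxK := hPsub hx
    have hyK := hPsub hy
    have hdisj : ¬ ((fc M x B₀).erase x ∩ (fc M y B₀).erase y).Nonempty := fun h => hnm ⟨x, hx, y, hy, hxy, h⟩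
    rw [card_union_fc_of_disjoint_traces (M := M) (Finset.mem_sdiff.1 hxK).2 (Finset.mem_sdiff.1 hyK).2 hxy hdisj]
    have := hc3 x hxK
    have := hc3 y hyK
    omega
  set K := G \ B₀ with hK
  set K₃ := K.filter (fun x => (fc M x B₀).card = 3) with hK₃
  set D₁ : ℚ := if K.card ≤ 2 then 0 else 1 with hD₁
  set D₂ : ℚ := if K.card ≤ 3 then 0 else 1 with hD₂
  have hK₃K : K₃ ⊆ K := Finset.filter_subset _ _
  have hK₃le := Finset.card_le_card hK₃K
  by_cases hspecial : K.card = 4 ∧ 3 ≤ K₃.card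
  · obtain ⟨hk4, hk₃3⟩ := hspecial
    have hD : D₁ = 1 := by rw [hD₁, if_neg (by omega)]
    have hD' : D₂ = 1 := by rw [hD₂, if_neg (by omega)]
    by_cases hk₃4 : K₃.card = 4
    · -- all four circuits are `3`-circuits: no meeting pair, every pair has `u ≥ 6`
      have hK₃eq : K₃ = K := Finset.eq_of_subset_of_card_le hK₃K (by omega)
      have hall : ∀ x ∈ K, (fc M x B₀).card - 1 = 2 := by
        intro x hx
        rw [← hK₃eq, hK₃, Finset.mem_filter] at hx
        omega
      have hS : ∑ x ∈ K, ((fc M x B₀).card - 1) ≤ 8 := by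
        rw [Finset.sum_congr rfl hall, Finset.sum_const, smul_eq_mul, hk4]
      have hempty := meetingPairs_eq_empty hG hrG hB hfree hS
      have h := charge_ge_of_bounds hs hG hrG hB (by norm_num) (8 / 21 - (8 / 21 - 2 / 189) * D₁) 0
        (2 / 21 - (2 / 21 - 22 / 675) * D₂) (fun x hx h3 => t3 x hx h3)
        (fun x hx h3 => absurd (hall x hx) (by omega)) (fun P hP => by
          refine tp6 P hP (hnonmeet P hP ?_)
          intro hm
          have : P ∈ (K.powersetCard 2).filter (fun P => MeetingPair M B₀ P) := Finset.mem_filter.2 ⟨hP, hm⟩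
          rw [hempty] at this
          exact Finset.notMem_empty P this)
      rw [hk4, hk₃4, hD, hD'] at h
      norm_num [Nat.choose] at h ⊢
      linarith
    · -- `k₃ = 3`: the fourth circuit `C_z`
      have hk₃3' : K₃.card = 3 := by omega
      have hone : (K \ K₃).card = 1 := by rw [Finset.card_sdiff_of_subset hK₃K]; omega
      obtain ⟨z, hz⟩ := Finset.card_eq_one.1 hone
      have hzK : z ∈ K := (Finset.mem_sdiff.1 (by rw [hz]; exact Finset.mem_singleton_self z)).1
      have hz3 : (fc M z B₀).card ≠ 3 := fun h =>
        (Finset.mem_sdiff.1 (by rw [hz]; exact Finset.mem_singleton_self z : z ∈ K \ K₃)).2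
          (Finset.mem_filter.2 ⟨hzK, h⟩)
      have honly : ∀ x ∈ K, (fc M x B₀).card ≠ 3 → x = z := by
        intro x hx h3
        have : x ∈ K \ K₃ := Finset.mem_sdiff.2 ⟨hx, fun h => h3 (Finset.mem_filter.1 h).2⟩
        rw [hz, Finset.mem_singleton] at this
        exact this
      by_cases hz4 : (fc M z B₀).card = 4
      · -- excess `1`: at most one meeting pair
        have hS : ∑ x ∈ K, ((fc M x B₀).card - 1) ≤ 8 + 1 := by
          rw [← Finset.sum_sdiff hK₃K, hz, Finset.sum_singleton, hz4]
          have : ∑ x ∈ K₃, ((fc M x B₀).card - 1) = ∑ _x ∈ K₃, 2 := by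
            apply Finset.sum_congr rfl
            intro x hx
            rw [hK₃, Finset.mem_filter] at hx
            omega
          rw [this, Finset.sum_const, smul_eq_mul, hk₃3']
        have hF := card_meetingPairs_le_one hG hrG hB hfree hS
        have h := charge_ge_of_bounds' hs hG hrG hB (by norm_num) (8 / 21 - (8 / 21 - 2 / 189) * D₁)
          (8 / 25 - (8 / 25 - 1 / 18) * D₁)
          (fun P => if MeetingPair M B₀ P then (2 / 21 - (2 / 21 - 1 / 45) * D₂ : ℚ) else
            2 / 21 - (2 / 21 - 22 / 675) * D₂)
          (fun x hx h3 => t3 x hx h3) (fun x hx h3 => t4 x hx h3)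
          (fun P hP => by
            split_ifs with hm
            · exact tp P hP
            · exact tp6 P hP (hnonmeet P hP hm))
        rw [hk4, hk₃3', Finset.sum_ite, Finset.sum_const, Finset.sum_const, nsmul_eq_mul,
          nsmul_eq_mul] at h
        have hcnt := Finset.card_filter_add_card_filter_not (s := K.powersetCard 2) (fun P => MeetingPair M B₀ P)
        rw [Finset.card_powersetCard, hk4] at hcnt
        have hnot : ((K.powersetCard 2).filter (fun P => ¬ MeetingPair M B₀ P)).card =
            6 - ((K.powersetCard 2).filter (fun P => MeetingPair M B₀ P)).card := by
          have : Nat.choose 4 2 = 6 := by decide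
          omega
        rw [hnot] at h
        have hf : ((K.powersetCard 2).filter (fun P => MeetingPair M B₀ P)).card ≤ 1 := hF
        set f := ((K.powersetCard 2).filter (fun P => MeetingPair M B₀ P)).card with hfdef
        have hf' : f = 0 ∨ f = 1 := by omega
        rw [hD, hD'] at h
        rcases hf' with h0 | h0 <;> rw [h0] at h <;> norm_num at h ⊢ <;> linarith
      · -- the fourth circuit has `≥ 5` points
        have hz5 : 5 ≤ (fc M z B₀).card := by have := hc3 z hzK; omega
        have h := charge_ge_of_bounds hs hG hrG hB (by norm_num) (8 / 21 - (8 / 21 - 2 / 189) * D₁)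
          (8 / 25 - (8 / 25 - 22 / 225) * D₁) (2 / 21 - (2 / 21 - 1 / 45) * D₂)
          (fun x hx h3 => t3 x hx h3)
          (fun x hx h3 => t5 x hx (by rw [honly x hx h3]; exact hz5))
          (fun P hP => tp P hP)
        rw [hk4, hk₃3', hD, hD'] at h
        norm_num [Nat.choose] at h ⊢
        linarith
  · have h := charge_ge_of_bounds hs hG hrG hB (by norm_num) (8 / 21 - (8 / 21 - 2 / 189) * D₁)
      (8 / 25 - (8 / 25 - 1 / 18) * D₁) (2 / 21 - (2 / 21 - 1 / 45) * D₂) t3 t4 tp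
    have harith := charge_arith_eight K.card K₃.card hk hk7 hK₃le hspecial D₁ D₂
      (by rw [hD₁]; split_ifs <;> norm_num) (by rw [hD₁]; split_ifs <;> norm_num)
      (by rw [hD₂]; split_ifs <;> norm_num) (by rw [hD₂]; split_ifs <;> norm_num)
      (fun h2 => by rw [hD₁, if_pos h2]) (fun h3 => by rw [hD₂, if_pos h3])
    linarith

/-! ## The `t = 2` window of `(10, 8)` -/

/-- **The type-`2` balance on every coloop-free rank-`8` flat with at most `15` points when lines have `≤ 3`
points.** -/
theorem jq_two_nonneg_of_lines_eight (hs : Simple M) (hline : ∀ L ∈ flatsQ M 2, L.card ≤ 3) {G : Finset α}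
    (hG : G ∈ flatsQ M 8) (hfree : mTr M G = 0) (hcard : G.card ≤ 15) : 0 ≤ Jq M G 8 2 := by
  have hGg : G ⊆ gr M := (mem_flatsQ.1 hG).1
  have hrG : M.eRk (G : Set α) = ((8 : ℕ) : ℕ∞) := (mem_flatsQ.1 hG).2.2
  apply Jq_two_nonneg_of_charge
  intro B₀ hB
  obtain ⟨hBG, hr, hc⟩ := mem_basesOf.1 hB
  have hkc : (G \ B₀).card = G.card - 8 := by rw [Finset.card_sdiff_of_subset hBG, hc]
  have hw : -(2 / 9 : ℚ) ≤ wTwo M G B₀ 8 := by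
    unfold wTwo wInf
    have hm : mTr M B₀ ≤ 8 := mTr_le_of_eRk_eq (hBG.trans hGg) hr
    have hm' : (mTr M B₀ : ℚ) ≤ 8 := by exact_mod_cast hm
    have hwinf : (1 : ℚ) / 9 ≤ 1 / (1 + (mTr M B₀ : ℚ)) := one_div_le_one_div_of_le (by positivity) (by linarith)
    have hd := dem_le_one (M := M) G B₀ 2
    push_cast
    nlinarith
  by_cases hk : (G \ B₀).card ≤ 1
  · have hd0 : dem M G 2 B₀ = 0 := dem_two_eq_zero_of_card_le_one hk
    have hw0 : 0 ≤ wTwo M G B₀ 8 := by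
      unfold wTwo
      rw [hd0]
      have := wInf_pos (M := M) B₀
      push_cast
      nlinarith
    have hch : 0 ≤ charge M G 8 B₀ := by
      have := charge_ge_sum_of_subset (q := 8) hs hGg (by norm_num) B₀ (T := ∅) (Finset.empty_subset _)
      rwa [Finset.sum_empty] at this
    linarith
  · have hch := tenEight_charge_ge hs hline hGg hrG hB hfree (by omega) (by omega)
    linarith

/-- **THE `t = 2` WINDOW OF THE `(10, 8)` ROW ON THE CORE**: on every Core matroid, every coloop-free rank-`8` flat
with at most `15` points satisfies the type-`2` balance `0 ≤ Jq M G 8 2`. -/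
theorem jq_two_nonneg_of_core_eight {γ : Type} [DecidableEq γ] {M : Matroid γ} [M.Finite] {p : ℕ} (hc : Core M p)
    {G : Finset γ} (hG : G ∈ flatsQ M 8) (hfree : mTr M G = 0) (hcard : G.card ≤ 15) : 0 ≤ Jq M G 8 2 :=
  jq_two_nonneg_of_lines_eight (simple_of_core hc) (fun _ hL => card_le_three_of_line_of_core hc hL) hG hfree hcard

/-- **The residue of the row `(10, 8)` at level `8`** on the coloop-free flats: the type-`1` balance when
`10 ≤ #G ≤ 13` and the type-`3 … 7` balances — `OpenLayersCoreFree 8` without its type-`2` clause. -/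
def TenEightResidueCoreFree : Prop :=
  ∀ {β : Type} [DecidableEq β] (M : Matroid β) [M.Finite] (G : Finset β), Core M 10 → G ∈ flatsQ M 8 →
    mTr M G = 0 → (10 ≤ G.card → G.card ≤ 13 → 0 ≤ Jq M G 8 1) ∧ (∀ t, 3 ≤ t → t ≤ 7 → 0 ≤ Jq M G 8 t)

/-- **`OpenLayersCoreFree 8` from the residue**: the type-`2` window `(g − 8)(g − 5) < 84`, i.e. `g ≤ 15`, is the
kernel theorem `jq_two_nonneg_of_core_eight`; the type-`1` window `(g − 8)·11 + 1 < 64` is `g ≤ 13`. -/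
theorem openLayersCoreFree_eight_of_residue (h : TenEightResidueCoreFree) : OpenLayersCoreFree 8 := by
  intro β _ M _ G hc hG _ hfree
  obtain ⟨h1, h3⟩ := h M G hc hG hfree
  refine ⟨fun _ h10 hwin => h1 h10 (by norm_num at hwin; omega), fun hwin => ?_,
    fun t ht3 ht => h3 t ht3 (by omega)⟩
  apply jq_two_nonneg_of_core_eight hc hG hfree
  by_contra hg
  push Not at hg
  have h8 : 8 ≤ G.card - 8 := by omega
  have h11 : 11 ≤ G.card - 8 + 3 := by omega
  have := Nat.mul_le_mul h8 h11
  omega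

/-- **C-025 at `(10, 8)` on every finite matroid** from the Core-typed layers of levels `5`, `6`, `7`, the level-`7`
trace sums and the `(10, 8)` residue on coloop-free flats. -/
theorem rls_ten_eight_of_residue {α : Type} [DecidableEq α] (h5 : OpenLayersCore 5) (h6 : OpenLayersCore 6)
    (h7 : OpenLayersCore 7) (htr : TraceSumsCore 7) (h8 : TenEightResidueCoreFree) (M : Matroid α) [M.Finite] :
    RLS M 10 8 := by
  refine rls_succ_succ_of_openLayersCore 8 (by norm_num) ?_ M
  intro q' hq'5 hq'
  rcases (show q' = 5 ∨ q' = 6 ∨ q' = 7 ∨ q' = 8 by omega) with rfl | rfl | rfl | rfl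
  · exact h5
  · exact h6
  · exact h7
  · exact openLayersCore_succ_of_free (by norm_num) htr (openLayersCoreFree_eight_of_residue h8)

end PercRepro.GenQ
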